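import Mathlib

/-!
# Real arithmetic of the beat at rest (negative side of `KolmogorovFloor`, stmt-AnomalousDissipation-14030)

cdisprove seat `refuter-cdisprove-stmt-AnomalousDissipation-14030-0` (2026-08-16). With `ν = s⁻¹²` and a
resolution `N ≤ C' s²` (`C' ≥ 1`, i.e. `N ≤ C ν^{-1/6}`): the lattice bookkeeping `N² + 2N + 5 ≤ 8C'²s⁴`,
`√#ball ≤ √(27C'³) s³` (`lattice_bounds`), the Leray-ball check for the dressed state (`ball_rest`), and the
contradiction `gain + ε₀ ≤ ‖f‖₂𝔊 + cost` ⇒ `False` for `s ≥ 10240(1+2Θ)C'⁴(‖f‖₂K₃ + 1)/ε₀ + 1`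
(`endgame_rest`). Pure real-number lemmas; used by `Negative/BeatAtRest.lean`.
-/

noncomputable section

namespace Summit.AnomalousDissipation.AnomalousDissipation.Theorems.KolmogorovFloor.Negative

/-- `ν = s⁻¹²` has `ν^{-1/6} = s²`. -/
theorem rpow_neg_sixth_inv_pow_twelve {s : ℝ} (hs : 0 < s) : ((s ^ 12)⁻¹ : ℝ) ^ (-(1 / 6 : ℝ)) = s ^ 2 := by
  have h12 : 0 ≤ s ^ 12 := by positivity
  rw [Real.rpow_neg (inv_nonneg.2 h12), Real.inv_rpow h12, inv_inv,
    show s ^ 12 = (s ^ 2) ^ 6 by ring, ← Real.rpow_natCast (s ^ 2) 6, ← Real.rpow_mul (by positivity)]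
  norm_num

/-! ### Real arithmetic of the endgame (`ν = s⁻¹²`, `N ≤ C' s²`) -/

/-- Resolution bookkeeping: `N² + 2N + 5 ≤ 8 C'² s⁴` and `√#ball ≤ √(27 C'³) s³`. -/
theorem lattice_bounds {C' s N card : ℝ} (hC' : 1 ≤ C') (hs1 : 1 ≤ s) (hN0 : 0 ≤ N) (hNs : N ≤ C' * s ^ 2)
    (hcard : card ≤ (2 * N + 1) ^ 3) :
    N ^ 2 + 2 * N + 5 ≤ 8 * C' ^ 2 * s ^ 4 ∧ Real.sqrt card ≤ Real.sqrt (27 * C' ^ 3) * s ^ 3 := by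
  have hs0 : 0 ≤ s := by linarith
  have hC0 : 0 ≤ C' := by linarith
  have hs2 : 1 ≤ s ^ 2 := one_le_pow₀ hs1
  have hCs : 1 ≤ C' * s ^ 2 := by nlinarith
  have hN2 : N ^ 2 ≤ (C' * s ^ 2) ^ 2 := pow_le_pow_left₀ hN0 hNs 2
  have hCs2 : C' * s ^ 2 ≤ (C' * s ^ 2) ^ 2 := by nlinarith
  refine ⟨by nlinarith, ?_⟩
  have h2N : 2 * N + 1 ≤ 3 * C' * s ^ 2 := by nlinarith
  have h1 : card ≤ 27 * C' ^ 3 * (s ^ 3) ^ 2 := by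
    calc card ≤ (2 * N + 1) ^ 3 := hcard
      _ ≤ (3 * C' * s ^ 2) ^ 3 := pow_le_pow_left₀ (by positivity) h2N 3
      _ = 27 * C' ^ 3 * (s ^ 3) ^ 2 := by ring
  calc Real.sqrt card ≤ Real.sqrt (27 * C' ^ 3 * (s ^ 3) ^ 2) := Real.sqrt_le_sqrt h1
    _ = Real.sqrt (27 * C' ^ 3) * s ^ 3 := by
        rw [Real.sqrt_mul (by positivity), Real.sqrt_sq (by positivity)]

/-- The dressed state fits in the Leray ball: `(α+α)² = 4(F√#ball + 1) ≤ 16 F² s²⁴` once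
`4F² s ≥ F K₃ + 1` (and `s ≥ 1`). -/
theorem ball_rest {F K₃ s α sc : ℝ} (hF : 0 < F) (hs1 : 1 ≤ s) (hsB : F * K₃ + 1 ≤ 4 * F ^ 2 * s)
    (hsc : sc ≤ K₃ * s ^ 3) (hα2 : α ^ 2 = F * sc + 1) :
    (α + α) ^ 2 ≤ 16 * F ^ 2 / ((s ^ 12)⁻¹) ^ 2 := by
  have hs0 : 0 < s := by linarith
  have e : ((s ^ 12)⁻¹ : ℝ) ^ 2 = (s ^ 24)⁻¹ := by rw [inv_pow, ← pow_mul]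
  rw [e, div_inv_eq_mul, show (α + α) ^ 2 = 4 * α ^ 2 by ring, hα2]
  have hs3 : 1 ≤ s ^ 3 := one_le_pow₀ hs1
  have hs21 : s ≤ s ^ 21 := by
    calc s = s ^ 1 := (pow_one s).symm
      _ ≤ s ^ 21 := pow_le_pow_right₀ hs1 (by norm_num)
  have hFsc : F * sc ≤ F * (K₃ * s ^ 3) := mul_le_mul_of_nonneg_left hsc hF.le
  have h2 : F * sc + 1 ≤ (F * K₃ + 1) * s ^ 3 := by nlinarith
  have hFK : 0 ≤ F * K₃ + 1 := by nlinarith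
  calc 4 * (F * sc + 1) ≤ 4 * ((F * K₃ + 1) * s ^ 3) := by linarith
    _ ≤ 4 * ((4 * F ^ 2 * s) * s ^ 3) := by gcongr
    _ ≤ 4 * ((4 * F ^ 2 * s ^ 21) * s ^ 3) := by gcongr
    _ = 16 * F ^ 2 * s ^ 24 := by ring

set_option maxHeartbeats 400000 in
/-- **Endgame at rest.** The consequence of the floor at the dressed state, `gain + ε₀ ≤ F 𝔊 + cost`, is absurd
for `s ≥ 10240 (1+2Θ) C'⁴ (F K₃ + 1)/ε₀ + 1`. -/
theorem endgame_rest {F Θ C' s K₃ N card 𝔊 gn ζn fq α ε₀ : ℝ} (hF : 0 < F) (hΘ : 0 ≤ Θ) (hC' : 1 ≤ C')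
    (hs1 : 1 ≤ s) (hε₀ : 0 < ε₀) (hK₃ : K₃ = Real.sqrt (27 * C' ^ 3))
    (hsS : 10240 * (1 + 2 * Θ) * C' ^ 4 * (F * K₃ + 1) / ε₀ + 1 ≤ s)
    (hN0 : 0 ≤ N) (hNs : N ≤ C' * s ^ 2) (hcard1 : 1 ≤ card) (hcard : card ≤ (2 * N + 1) ^ 3)
    (h𝔊0 : 0 ≤ 𝔊) (h𝔊 : 𝔊 ^ 2 ≤ card * gn ^ 2) (hgn : 0 ≤ gn) (hζn : 0 ≤ ζn) (hgζ : gn ^ 2 ≤ 2 * ζn ^ 2)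
    (hfq1 : 1 ≤ fq) (hα2 : α ^ 2 = F * Real.sqrt card + 1)
    (hmain : Real.pi * α * α * Real.sqrt fq * ζn + ε₀ ≤
      F * 𝔊 + (1 + 2 * Θ) * ((s ^ 12)⁻¹ * (4 * Real.pi ^ 2 * (N ^ 2 + 2 * N + 5) ^ 2 * (α + α) ^ 2))) : False := by
  have hs0 : 0 < s := by linarith
  have hK₃0 : 0 ≤ K₃ := by rw [hK₃]; exact Real.sqrt_nonneg _
  obtain ⟨hL, hsc⟩ := lattice_bounds hC' hs1 hN0 hNs hcard
  rw [← hK₃] at hsc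
  have hsc0 : 0 ≤ Real.sqrt card := Real.sqrt_nonneg _
  -- the multiplier norm through its largest coefficient
  have h𝔊le : 𝔊 ≤ Real.sqrt card * gn := by
    have : 𝔊 ^ 2 ≤ (Real.sqrt card * gn) ^ 2 := by
      rw [mul_pow, Real.sq_sqrt (by linarith)]; exact h𝔊
    exact (pow_le_pow_iff_left₀ h𝔊0 (by positivity) two_ne_zero).1 this
  -- the gain
  have hgain : 2 * α ^ 2 * gn ≤ Real.pi * α * α * Real.sqrt fq * ζn := by
    have h1 : 2 * gn ≤ 3 * ζn := by
      have e1 : (2 * gn) ^ 2 = 4 * gn ^ 2 := by ring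
      have e2 : (3 * ζn) ^ 2 = 9 * ζn ^ 2 := by ring
      have : (2 * gn) ^ 2 ≤ (3 * ζn) ^ 2 := by rw [e1, e2]; linarith [sq_nonneg ζn]
      exact (pow_le_pow_iff_left₀ (by positivity) (by positivity) two_ne_zero).1 this
    have h2 : 1 ≤ Real.sqrt fq := by
      rw [show (1 : ℝ) = Real.sqrt 1 by simp]
      exact Real.sqrt_le_sqrt hfq1
    have h3 : 3 ≤ Real.pi := by linarith [Real.pi_gt_three]
    have hα20 : 0 ≤ α ^ 2 := sq_nonneg α
    calc 2 * α ^ 2 * gn = α ^ 2 * (2 * gn) := by ring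
      _ ≤ α ^ 2 * (3 * ζn) := mul_le_mul_of_nonneg_left h1 hα20
      _ = 3 * (α ^ 2 * ζn) * 1 := by ring
      _ ≤ Real.pi * (α ^ 2 * ζn) * Real.sqrt fq := by gcongr
      _ = Real.pi * α * α * Real.sqrt fq * ζn := by ring
  -- the cost
  set T : ℝ := (1 + 2 * Θ) * C' ^ 4 * (F * K₃ + 1) with hT
  have hT0 : 0 < T := by rw [hT]; positivity
  have hs3 : 1 ≤ s ^ 3 := one_le_pow₀ hs1
  have hαα : (α + α) ^ 2 ≤ 4 * (F * K₃ + 1) * s ^ 3 := by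
    rw [show (α + α) ^ 2 = 4 * α ^ 2 by ring, hα2]
    have : F * Real.sqrt card ≤ F * K₃ * s ^ 3 := by
      calc F * Real.sqrt card ≤ F * (K₃ * s ^ 3) := mul_le_mul_of_nonneg_left hsc hF.le
        _ = F * K₃ * s ^ 3 := by ring
    have e3 : 4 * (F * K₃ + 1) * s ^ 3 = 4 * (F * K₃ * s ^ 3) + 4 * s ^ 3 := by ring
    rw [e3]
    linarith
  have hL2 : (N ^ 2 + 2 * N + 5) ^ 2 ≤ 64 * C' ^ 4 * s ^ 8 := by
    calc (N ^ 2 + 2 * N + 5) ^ 2 ≤ (8 * C' ^ 2 * s ^ 4) ^ 2 := pow_le_pow_left₀ (by positivity) hL 2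
      _ = 64 * C' ^ 4 * s ^ 8 := by ring
  have hcost : (1 + 2 * Θ) * ((s ^ 12)⁻¹ * (4 * Real.pi ^ 2 * (N ^ 2 + 2 * N + 5) ^ 2 * (α + α) ^ 2)) ≤
      1024 * Real.pi ^ 2 * T * s⁻¹ := by
    have h2 : (s ^ 12)⁻¹ * (4 * Real.pi ^ 2 * (64 * C' ^ 4 * s ^ 8) * (4 * (F * K₃ + 1) * s ^ 3)) =
        1024 * Real.pi ^ 2 * (C' ^ 4 * (F * K₃ + 1)) * s⁻¹ := by
      field_simp
      ring
    calc (1 + 2 * Θ) * ((s ^ 12)⁻¹ * (4 * Real.pi ^ 2 * (N ^ 2 + 2 * N + 5) ^ 2 * (α + α) ^ 2))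
        ≤ (1 + 2 * Θ) * ((s ^ 12)⁻¹ * (4 * Real.pi ^ 2 * (64 * C' ^ 4 * s ^ 8) * (4 * (F * K₃ + 1) * s ^ 3))) := by
          gcongr
      _ = 1024 * Real.pi ^ 2 * T * s⁻¹ := by rw [h2, hT]; ring
  -- assemble: `ε₀ ≤ cost`
  have hFg : F * 𝔊 ≤ F * (Real.sqrt card * gn) := mul_le_mul_of_nonneg_left h𝔊le hF.le
  have hε : ε₀ ≤ 1024 * Real.pi ^ 2 * T * s⁻¹ := by
    have e : 2 * α ^ 2 * gn = 2 * (F * (Real.sqrt card * gn)) + 2 * gn := by rw [hα2]; ring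
    have hX : 0 ≤ F * (Real.sqrt card * gn) := mul_nonneg hF.le (mul_nonneg hsc0 hgn)
    linarith [hmain, hgain, hcost, hFg, e, hX]
  -- `π² < 10` and the choice of `s`
  have hpi : Real.pi ^ 2 < 10 := by
    have h' : Real.pi ^ 2 < (3.15 : ℝ) ^ 2 := pow_lt_pow_left₀ Real.pi_lt_d2 Real.pi_pos.le two_ne_zero
    norm_num at h'
    linarith
  have hsT : 10240 * T ≤ ε₀ * (s - 1) := by
    rw [hT]
    have : 10240 * (1 + 2 * Θ) * C' ^ 4 * (F * K₃ + 1) / ε₀ ≤ s - 1 := by linarith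
    rw [div_le_iff₀ hε₀] at this
    linarith
  have h1 : ε₀ * s ≤ 1024 * Real.pi ^ 2 * T := by
    have := mul_le_mul_of_nonneg_right hε hs0.le
    rwa [mul_assoc, inv_mul_cancel₀ hs0.ne', mul_one] at this
  have h2 : Real.pi ^ 2 * T < 10 * T := mul_lt_mul_of_pos_right hpi hT0
  linarith [h1, h2, hsT, hε₀]


end Summit.AnomalousDissipation.AnomalousDissipation.Theorems.KolmogorovFloor.Negative
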